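import Literature.MathematicalPhysics.QuantumLattice.FermiRG.FKTLaddersSupportVanishing

/-!
# Feldman–Knörrer–Trubowitz, *Particle–Hole Ladders*: Fourier inversion on `ℝ × ℝ²` in the paper's conventions

Theorem-only companion of the typer file `FKTLaddersSec1.lean` (F7a, frozen; nothing there is edited)
for the cell `gate-hubbard-kl` (seat hubbard-kl-t10, gen 2): the pointwise Fourier inversion of the
sector cut-off transforms `χ̂_s(x) = ∫ e^{-i⟨k,x⟩_-} χ_s(k) d³k/(2π)³` (§I.7, p.8 L34–38 of
J. Feldman, H. Knörrer, E. Trubowitz, *Particle–Hole Ladders*, Commun. Math. Phys. **247** (2004)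
179–194, arXiv:math-ph/0209044 [FeldmanKnorrerTrubowitz2004Ladders]; tree: `FKTLadders.chiHat`,
pairing `⟨k, x⟩_- = -k₀x₀ + 𝐤·𝐱` = `FKTLadders.mink`), needed for the support step of Lemma II.16
(`\lemLADresectornorm`) on the components with exactly one position leg: there the `s'`-summand of
the resectorisation is `c(k) · e^{i⟨K, y_ν⟩_-} · ∫ χ̂_{s_ν}(w) e^{i⟨q_ν, w⟩_-} dw`, and
`∫ χ̂(w) e^{i⟨q, w⟩_-} d³w = χ(q)` IS Fourier inversion.

Mathlib proves the inversion formula `𝓕⁻ (𝓕 f) v = f v` for `f`, `𝓕 f` integrable and `f`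
continuous at `v` on a finite-dimensional real inner product space
(`MeasureTheory.Integrable.fourierInv_fourier_eq`, with `𝓕 f (ξ) = ∫ e^{-2πi⟪v,ξ⟫} f(v) dv`).  This
file transports it to the carrier `SpT = ℝ × (Fin 2 → ℝ)` (sup norm, NOT an inner product space) with
the indefinite pairing `⟨·,·⟩_-`, the character `e^{i·}` and the measure `d³k/(2π)³`: along the
measure-preserving equivalence `Ψ : ℝ × ℝ² ≃ᵐ EuclideanSpace ℝ (Fin 3)` (Fin-insertion composed with
`WithLp.toLp`) one has `⟨k, x⟩_- = ⟪Ψ k, Ψ (-x₀, 𝐱)⟫`, hence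
`χ̂(x) = (2π)⁻³ · 𝓕 (χ ∘ Ψ⁻¹) ((2π)⁻¹ • Ψ (-x₀, 𝐱))` and
`∫ χ̂(w) e^{i⟨q,w⟩_-} d³w = 𝓕⁻ (𝓕 (χ ∘ Ψ⁻¹)) (Ψ q)` (the Jacobian `(2π)³` of the rescaling cancels the
prefactor).

## Contents (all proved; no `def`, no named fact)

* `exists_measurableEquiv_euclideanSpace` — the transport `Ψ` (measure preserving, continuous inverse,
  `⟪Ψ k, Ψ w⟫ = k₀w₀ + 𝐤·𝐰`).
* `integral_chiHat_mul_cexp_eq_self` — **inversion**: `χ`, `χ̂` integrable, `χ` continuous at `q` ⇒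
  `∫ χ̂(w) e^{i⟨q,w⟩_-} d³w = χ(q)`.
* `integral_chiHat_mul_cexp_eq_zero_of_eventuallyEq` — if `χ ≡ 0` near `q` then
  `∫ χ̂(w) e^{i⟨q,w⟩_-} d³w = 0`, with NO integrability hypothesis (non-integrable `χ` or `χ̂` give
  Bochner-junk zeros).
* `integral_chiHat_smul_sub_mul_cexp`, `…_eq_zero` — the same for the kernel as it occurs in a
  resectorisation leg, `∫ χ̂(σ(y - x)) e^{i⟨K,x⟩_-} dx = e^{i⟨K,y⟩_-} ∫ χ̂(w) e^{i⟨-σK, w⟩_-} dw`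
  (`σ = ±1`), which vanishes when `χ ≡ 0` near the conserved momentum `-σK`.

[folklore] transport; the mathematical content is Mathlib's inversion theorem.
-/

noncomputable section

open MeasureTheory Filter
open scoped RealInnerProductSpace FourierTransform Topology

namespace Literature.MathematicalPhysics.QuantumLattice.FermiRG

namespace FKTLadders

/-! ### §1 A Euclidean model of `ℝ × ℝ²` -/

/-- Evaluation of `Fin.cons` at `2 : Fin 3`. [folklore] -/
private theorem cons_apply_two (a : ℝ) (g : Fin 2 → ℝ) : (Fin.cons a g : Fin 3 → ℝ) 2 = g 1 := rfl

/-- **The Euclidean model.**  There is a measurable equivalence `Ψ : ℝ × ℝ² ≃ᵐ EuclideanSpace ℝ (Fin 3)`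
preserving Lebesgue measure, with continuous inverse, which carries the coordinate pairing to the
Euclidean inner product: `⟪Ψ k, Ψ w⟫ = k₀w₀ + 𝐤₁𝐰₁ + 𝐤₂𝐰₂` (so that `⟨k, x⟩_- = ⟪Ψ k, Ψ(-x₀, 𝐱)⟫`).
[folklore] -/
private theorem exists_measurableEquiv_euclideanSpace :
    ∃ Ψ : SpT ≃ᵐ EuclideanSpace ℝ (Fin 3), MeasurePreserving Ψ volume volume ∧
      Continuous Ψ.symm ∧
      ∀ k w : SpT, ⟪Ψ k, Ψ w⟫ = k.1 * w.1 + (k.2 0 * w.2 0 + k.2 1 * w.2 1) := by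
  let Ψ : SpT ≃ᵐ EuclideanSpace ℝ (Fin 3) :=
    ((MeasurableEquiv.piFinSuccAbove (fun _ : Fin 3 => ℝ) 0).symm).trans
      (MeasurableEquiv.toLp 2 (Fin 3 → ℝ))
  have hΨ : ∀ k : SpT, Ψ k = WithLp.toLp 2 (Fin.cons k.1 k.2 : Fin 3 → ℝ) := by
    intro k
    simp [Ψ, MeasurableEquiv.trans_apply, MeasurableEquiv.piFinSuccAbove_symm_apply]
    rfl
  have hΨs : (Ψ.symm : EuclideanSpace ℝ (Fin 3) → SpT) =
      fun v => (MeasurableEquiv.piFinSuccAbove (fun _ : Fin 3 => ℝ) 0) (WithLp.ofLp v) := by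
    funext v
    rfl
  refine ⟨Ψ, ?_, ?_, ?_⟩
  · exact ((volume_preserving_piFinSuccAbove (fun _ : Fin 3 => ℝ) 0).symm).trans
      (PiLp.volume_preserving_toLp (Fin 3))
  · rw [hΨs]
    refine Continuous.comp ?_ (PiLp.continuous_ofLp 2 _)
    refine Continuous.prodMk (continuous_apply 0) ?_
    exact continuous_pi fun j => continuous_apply _
  · intro k w
    rw [hΨ, hΨ, PiLp.inner_apply]
    simp [Fin.sum_univ_three, cons_apply_two]
    ring

/-- Lebesgue measure on `ℝ × ℝ²` is preserved by the reflection `(x₀, 𝐱) ↦ (-x₀, 𝐱)` (as a measurable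
equivalence). [folklore] -/
private theorem measurePreserving_negFst :
    MeasurePreserving (MeasurableEquiv.prodCongr (MeasurableEquiv.neg ℝ)
      (MeasurableEquiv.refl (Fin 2 → ℝ)) : SpT ≃ᵐ SpT) volume volume :=
  (Measure.measurePreserving_neg (volume : Measure ℝ)).prod
    (MeasurePreserving.id (volume : Measure (Fin 2 → ℝ)))

/-- The reflection equivalence acts as `(x₀, 𝐱) ↦ (-x₀, 𝐱)`. [folklore] -/
private theorem prodCongr_neg_refl_apply (w : SpT) :
    (MeasurableEquiv.prodCongr (MeasurableEquiv.neg ℝ) (MeasurableEquiv.refl (Fin 2 → ℝ)) :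
      SpT ≃ᵐ SpT) w = ((-w.1, w.2) : SpT) := rfl

/-! ### §2 `χ̂` and the inverse integral through Mathlib's `𝓕`, `𝓕⁻` -/

section Transport

variable (Ψ : SpT ≃ᵐ EuclideanSpace ℝ (Fin 3)) (hmp : MeasurePreserving Ψ volume volume)
  (hinner : ∀ k w : SpT, ⟪Ψ k, Ψ w⟫ = k.1 * w.1 + (k.2 0 * w.2 0 + k.2 1 * w.2 1))

include hinner in
/-- The pairing `⟨k, x⟩_-` is the Euclidean inner product after reflecting the time coordinate.
[cite: FeldmanKnorrerTrubowitz2004Ladders, Definition I.4 (p.5 L61)] -/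
theorem mink_eq_inner (k x : SpT) : mink k x = ⟪Ψ k, Ψ ((-x.1, x.2) : SpT)⟫ := by
  rw [hinner, mink]
  simp only
  ring

include hmp hinner in
/-- **`χ̂` is a rescaled Mathlib Fourier transform**:
`χ̂(x) = (2π)⁻³ · 𝓕 (χ ∘ Ψ⁻¹) ((2π)⁻¹ • Ψ(-x₀, 𝐱))`.
[cite: FeldmanKnorrerTrubowitz2004Ladders, §I.7 (p.8 L34–38)] -/
theorem chiHat_eq_fourier (χ : SpT → ℝ) (x : SpT) :
    chiHat χ x = ((2 * Real.pi) ^ (3 : ℕ) : ℂ)⁻¹ *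
      𝓕 (fun v : EuclideanSpace ℝ (Fin 3) => (χ (Ψ.symm v) : ℂ))
        ((2 * Real.pi)⁻¹ • Ψ ((-x.1, x.2) : SpT)) := by
  unfold chiHat
  congr 1
  rw [Real.fourier_eq',
    ← hmp.integral_comp' (fun v : EuclideanSpace ℝ (Fin 3) =>
      Complex.exp (↑(-2 * Real.pi * ⟪v, (2 * Real.pi)⁻¹ • Ψ ((-x.1, x.2) : SpT)⟫) * Complex.I) •
        (χ (Ψ.symm v) : ℂ))]
  refine integral_congr_ae (ae_of_all _ fun k => ?_)
  simp only [MeasurableEquiv.symm_apply_apply, smul_eq_mul, real_inner_smul_right,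
    ← mink_eq_inner Ψ hinner]
  congr 1
  have hπ : (2 * Real.pi) ≠ 0 := by positivity
  have h1 : -2 * Real.pi * ((2 * Real.pi)⁻¹ * mink k x) = -mink k x := by
    field_simp
  rw [h1]
  push_cast
  ring_nf

include hmp hinner in
/-- **The inverse integral is Mathlib's `𝓕⁻ ∘ 𝓕`**:
`∫ χ̂(w) e^{i⟨q,w⟩_-} d³w = 𝓕⁻ (𝓕 (χ ∘ Ψ⁻¹)) (Ψ q)` (no hypothesis on `χ`: both sides are the same
iterated integral after the substitution `u = (2π)⁻¹ • Ψ(-w₀, 𝐰)`, whose Jacobian `(2π)³` cancels the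
prefactor of `χ̂`). [cite: FeldmanKnorrerTrubowitz2004Ladders, §I.7 (p.8 L34–38)] -/
theorem integral_chiHat_mul_cexp_eq_fourierInv (χ : SpT → ℝ) (q : SpT) :
    ∫ w, chiHat χ w * Complex.exp (Complex.I * (mink q w : ℂ)) =
      𝓕⁻ (𝓕 (fun v : EuclideanSpace ℝ (Fin 3) => (χ (Ψ.symm v) : ℂ))) (Ψ q) := by
  set G : EuclideanSpace ℝ (Fin 3) → ℂ := 𝓕 (fun v : EuclideanSpace ℝ (Fin 3) => (χ (Ψ.symm v) : ℂ))
    with hG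
  set H : EuclideanSpace ℝ (Fin 3) → ℂ := fun u =>
    Complex.exp (↑(2 * Real.pi * ⟪u, Ψ q⟫) * Complex.I) • G u with hH
  have hRHS : 𝓕⁻ G (Ψ q) = ∫ u, H u := by rw [Real.fourierInv_eq']
  rw [hRHS]
  -- the reflection-and-transport equivalence and the rescaling constant
  set Rm : SpT ≃ᵐ SpT := MeasurableEquiv.prodCongr (MeasurableEquiv.neg ℝ)
    (MeasurableEquiv.refl (Fin 2 → ℝ)) with hRm
  have hRΨ : MeasurePreserving (Rm.trans Ψ) volume volume := measurePreserving_negFst.trans hmp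
  set c : ℝ := (2 * Real.pi)⁻¹ with hc
  have hπ : (0 : ℝ) < 2 * Real.pi := by positivity
  -- pointwise: the integrand is `(2π)⁻³ · H (c • Ψ (Rm w))`
  have hpt : ∀ w : SpT, chiHat χ w * Complex.exp (Complex.I * (mink q w : ℂ)) =
      ((2 * Real.pi) ^ (3 : ℕ) : ℂ)⁻¹ * H (c • (Rm.trans Ψ) w) := by
    intro w
    rw [chiHat_eq_fourier Ψ hmp hinner χ w, MeasurableEquiv.trans_apply, prodCongr_neg_refl_apply,
      hH]
    simp only [smul_eq_mul]
    rw [real_inner_smul_left, real_inner_comm, ← mink_eq_inner Ψ hinner, hc]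
    have h1 : 2 * Real.pi * ((2 * Real.pi)⁻¹ * mink q w) = mink q w := by
      field_simp
    rw [h1, mul_assoc]
    congr 1
    rw [mul_comm]
    congr 1
    ring_nf
  simp_rw [hpt]
  rw [integral_const_mul, hRΨ.integral_comp' (fun u => H (c • u)),
    Measure.integral_comp_smul volume H c]
  simp only [finrank_euclideanSpace_fin, Complex.real_smul]
  rw [← mul_assoc]
  have hcst : ((2 * Real.pi) ^ (3 : ℕ) : ℂ)⁻¹ * (↑|(c ^ 3)⁻¹| : ℂ) = 1 := by
    rw [hc, inv_pow, inv_inv, abs_of_pos (pow_pos hπ 3)]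
    push_cast
    exact inv_mul_cancel₀ (by exact_mod_cast (pow_pos hπ 3).ne')
  rw [hcst, one_mul]

include hmp in
/-- Integrability is transported along `Ψ`. [folklore] -/
private theorem integrable_comp_symm_iff (g : SpT → ℂ) :
    Integrable (fun v : EuclideanSpace ℝ (Fin 3) => g (Ψ.symm v)) ↔ Integrable g :=
  hmp.symm.integrable_comp_emb Ψ.symm.measurableEmbedding

include hmp hinner in
/-- If `χ̂ ∈ L¹(ℝ × ℝ²)` then the Mathlib Fourier transform of `χ ∘ Ψ⁻¹` is integrable (it is a
rescaled copy of `χ̂`). [cite: FeldmanKnorrerTrubowitz2004Ladders, §I.7 (p.8 L34–38)] -/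
theorem integrable_fourier_of_integrable_chiHat (χ : SpT → ℝ) (hχ' : Integrable (chiHat χ)) :
    Integrable (𝓕 (fun v : EuclideanSpace ℝ (Fin 3) => (χ (Ψ.symm v) : ℂ))) := by
  set G : EuclideanSpace ℝ (Fin 3) → ℂ := 𝓕 (fun v : EuclideanSpace ℝ (Fin 3) => (χ (Ψ.symm v) : ℂ))
    with hG
  set Rm : SpT ≃ᵐ SpT := MeasurableEquiv.prodCongr (MeasurableEquiv.neg ℝ)
    (MeasurableEquiv.refl (Fin 2 → ℝ)) with hRm
  have hRΨ : MeasurePreserving (Rm.trans Ψ) volume volume := measurePreserving_negFst.trans hmp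
  set c : ℝ := (2 * Real.pi)⁻¹ with hc
  have hπ : (0 : ℝ) < 2 * Real.pi := by positivity
  have hc0 : c ≠ 0 := inv_ne_zero hπ.ne'
  -- `G (c • Ψ(Rm w)) = (2π)³ χ̂(w)` is integrable in `w`
  have h1 : Integrable (fun w : SpT => G (c • (Rm.trans Ψ) w)) := by
    have h2 : (fun w : SpT => G (c • (Rm.trans Ψ) w)) =
        fun w => ((2 * Real.pi) ^ (3 : ℕ) : ℂ) * chiHat χ w := by
      funext w
      rw [chiHat_eq_fourier Ψ hmp hinner χ w, MeasurableEquiv.trans_apply, prodCongr_neg_refl_apply,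
        ← mul_assoc, mul_inv_cancel₀ (by exact_mod_cast (pow_pos hπ 3).ne'), one_mul]
    rw [h2]
    exact hχ'.const_mul _
  have h3 : Integrable (fun u : EuclideanSpace ℝ (Fin 3) => G (c • u)) :=
    (hRΨ.integrable_comp_emb (Rm.trans Ψ).measurableEmbedding).1 h1
  exact (integrable_comp_smul_iff volume G hc0).1 h3

end Transport

/-! ### §3 Fourier inversion for `χ̂` and its consequences -/

/-- **Fourier inversion in the conventions of §I.7.**  If `χ ∈ L¹(ℝ × ℝ²)`, `χ̂ ∈ L¹` and `χ` is
continuous at `q`, then `∫ χ̂(w) e^{i⟨q, w⟩_-} d³w = χ(q)` (the prefactor `(2π)⁻³` sits in `χ̂`).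
Mathlib's `Integrable.fourierInv_fourier_eq` transported along the Euclidean model. [cite: FeldmanKnorrerTrubowitz2004Ladders, §I.7 (p.8 L34–38)] -/
theorem integral_chiHat_mul_cexp_eq_self (χ : SpT → ℝ) (hχ : Integrable fun p : SpT => (χ p : ℂ))
    (hχ' : Integrable (chiHat χ)) {q : SpT} (hq : ContinuousAt χ q) :
    ∫ w, chiHat χ w * Complex.exp (Complex.I * (mink q w : ℂ)) = χ q := by
  obtain ⟨Ψ, hmp, hcont, hinner⟩ := exists_measurableEquiv_euclideanSpace
  rw [integral_chiHat_mul_cexp_eq_fourierInv Ψ hmp hinner χ q]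
  have hχE : Integrable (fun v : EuclideanSpace ℝ (Fin 3) => (χ (Ψ.symm v) : ℂ)) :=
    (integrable_comp_symm_iff Ψ hmp (fun p => (χ p : ℂ))).2 hχ
  have hFE := integrable_fourier_of_integrable_chiHat Ψ hmp hinner χ hχ'
  have hqE : ContinuousAt (fun v : EuclideanSpace ℝ (Fin 3) => (χ (Ψ.symm v) : ℂ)) (Ψ q) := by
    have h1 : ContinuousAt χ (Ψ.symm (Ψ q)) := by rwa [Ψ.symm_apply_apply]
    have h2 : ContinuousAt (fun v : EuclideanSpace ℝ (Fin 3) => χ (Ψ.symm v)) (Ψ q) :=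
      ContinuousAt.comp (f := Ψ.symm) h1 hcont.continuousAt
    exact (Complex.continuous_ofReal.continuousAt).comp h2
  rw [MeasureTheory.Integrable.fourierInv_fourier_eq hχE hFE hqE, Ψ.symm_apply_apply]

/-- **Vanishing off the support.**  If `χ ≡ 0` on a neighbourhood of `q` then
`∫ χ̂(w) e^{i⟨q, w⟩_-} d³w = 0` — by inversion when `χ`, `χ̂ ∈ L¹`, and trivially otherwise (a
non-integrable `χ` has `χ̂ ≡ 0` by the Bochner convention; a non-integrable `χ̂` makes the
integrand non-integrable). [cite: FeldmanKnorrerTrubowitz2004Ladders, §I.7 (p.8 L34–38)] -/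
theorem integral_chiHat_mul_cexp_eq_zero_of_eventuallyEq (χ : SpT → ℝ) {q : SpT}
    (h0 : ∀ᶠ p in 𝓝 q, χ p = 0) :
    ∫ w, chiHat χ w * Complex.exp (Complex.I * (mink q w : ℂ)) = 0 := by
  by_cases hχ : Integrable fun p : SpT => (χ p : ℂ)
  swap
  · simp [chiHat_eq_zero_of_not_integrable χ hχ]
  by_cases hχ' : Integrable (chiHat χ)
  swap
  · refine integral_undef fun hint => hχ' ?_
    have hmeas : AEStronglyMeasurable
        (fun w : SpT => Complex.exp (-(Complex.I * (mink q w : ℂ)))) volume := by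
      refine Continuous.aestronglyMeasurable ?_
      fun_prop
    have h := hint.bdd_mul hmeas (c := 1) (ae_of_all _ fun w => le_of_eq (by
      rw [Complex.norm_exp]; simp))
    refine h.congr (ae_of_all _ fun w => ?_)
    show Complex.exp (-(Complex.I * (mink q w : ℂ))) *
        (chiHat χ w * Complex.exp (Complex.I * (mink q w : ℂ))) = chiHat χ w
    rw [mul_comm, mul_assoc, ← Complex.exp_add, add_neg_cancel, Complex.exp_zero, mul_one]
  have hq : ContinuousAt χ q :=
    (continuousAt_congr (show χ =ᶠ[𝓝 q] fun _ => (0 : ℝ) from h0)).2 continuousAt_const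
  rw [integral_chiHat_mul_cexp_eq_self χ hχ hχ' hq, h0.self_of_nhds]
  simp

/-! ### §2′ Invariances of Lebesgue measure on `ℝ × ℝ²` used for the substitutions (private) -/

/-- `volume` on `ℝ × ℝ²` is an additive Haar measure. [folklore] -/
private theorem isAddHaarMeasure_volume_SpT : (volume : Measure SpT).IsAddHaarMeasure := by
  rw [Measure.volume_eq_prod]; infer_instance

/-- `volume` on `ℝ × ℝ²` is invariant under `x ↦ -x`. [folklore] -/
private theorem isNegInvariant_volume_SpT : (volume : Measure SpT).IsNegInvariant := by
  haveI := isAddHaarMeasure_volume_SpT; infer_instance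

/-- `volume` on `ℝ × ℝ²` is invariant under left translations. [folklore] -/
private theorem isAddLeftInvariant_volume_SpT : (volume : Measure SpT).IsAddLeftInvariant := by
  haveI := isAddHaarMeasure_volume_SpT; infer_instance

/-- `⟨-k, x⟩_- = -⟨k, x⟩_-`. [cite: FeldmanKnorrerTrubowitz2004Ladders, Definition I.4 (p.5 L61)] -/
theorem mink_neg_left (k x : SpT) : mink (-k) x = -mink k x := by
  simp only [mink, Prod.fst_neg, Prod.snd_neg, Pi.neg_apply]; ring

/-- **The resectorisation kernel against a plane wave.**  For `σ = ±1`,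
`∫ χ̂(σ(y - x)) e^{i⟨K,x⟩_-} d³x = e^{i⟨K,y⟩_-} · ∫ χ̂(w) e^{i⟨-σK, w⟩_-} d³w`
(substitutions `x = y - v`, `v = σ w`). [cite: FeldmanKnorrerTrubowitz2004Ladders, Definition I.18 (p.8 L55–93) with §I.7 (p.8 L34–38)] -/
theorem integral_chiHat_smul_sub_mul_cexp (χ : SpT → ℝ) (σ : ℝ) (hσ : σ = 1 ∨ σ = -1)
    (y K : SpT) :
    ∫ x, chiHat χ (σ • (y - x)) * Complex.exp (Complex.I * (mink K x : ℂ)) =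
      Complex.exp (Complex.I * (mink K y : ℂ)) *
        ∫ w, chiHat χ w * Complex.exp (Complex.I * (mink (-(σ • K)) w : ℂ)) := by
  haveI := isNegInvariant_volume_SpT
  haveI := isAddLeftInvariant_volume_SpT
  -- Step 1: `x = y - v`
  set F : SpT → ℂ := fun v => chiHat χ (σ • v) * Complex.exp (Complex.I * (mink K (y - v) : ℂ))
    with hF
  have h1 : (fun x => chiHat χ (σ • (y - x)) * Complex.exp (Complex.I * (mink K x : ℂ))) =
      fun x => F (y - x) := by
    funext x
    simp only [hF, sub_sub_cancel]
  rw [h1, integral_sub_left_eq_self F volume y]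
  -- Step 2: split the phase and pull out the constant
  have h2 : ∀ v, F v = Complex.exp (Complex.I * (mink K y : ℂ)) *
      (chiHat χ (σ • v) * Complex.exp (-(Complex.I * (mink K v : ℂ)))) := by
    intro v
    simp only [hF, mink_sub_right, Complex.ofReal_sub, mul_sub, Complex.exp_sub]
    rw [Complex.exp_neg]
    field_simp
  simp_rw [h2]
  rw [integral_const_mul]
  congr 1
  -- Step 3: `v = σ w`
  rcases hσ with rfl | rfl
  · refine integral_congr_ae (ae_of_all _ fun v => ?_)
    simp only [one_smul, mink_neg_left, Complex.ofReal_neg, mul_neg]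
  · rw [← integral_neg_eq_self _ volume]
    refine integral_congr_ae (ae_of_all _ fun v => ?_)
    simp only [neg_smul, one_smul, neg_neg, mink_neg_right, Complex.ofReal_neg, mul_neg]

/-- **Vanishing of the single-leg resectorisation integral.**  For `σ = ±1`, if `χ ≡ 0` on a
neighbourhood of the momentum `-σK`, then `∫ χ̂(σ(y - x)) e^{i⟨K,x⟩_-} d³x = 0` for every `y`.
[cite: FeldmanKnorrerTrubowitz2004Ladders, Lemma II.16, proof (p.13 L43–53), with Definition I.18 (p.8 L55–93)] -/
theorem integral_chiHat_smul_sub_mul_cexp_eq_zero (χ : SpT → ℝ) (σ : ℝ) (hσ : σ = 1 ∨ σ = -1)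
    (y K : SpT) (h0 : ∀ᶠ p in 𝓝 (-(σ • K)), χ p = 0) :
    ∫ x, chiHat χ (σ • (y - x)) * Complex.exp (Complex.I * (mink K x : ℂ)) = 0 := by
  rw [integral_chiHat_smul_sub_mul_cexp χ σ hσ y K,
    integral_chiHat_mul_cexp_eq_zero_of_eventuallyEq χ h0, mul_zero]

end FKTLadders

end Literature.MathematicalPhysics.QuantumLattice.FermiRG
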